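import Mathlib
import Summits.NavierStokesRegularity.NavierStokesRegularity.Theorems.FilamentSkeletonRssSkeletonJ1RLiaSelfDerivRadial
import Summits.NavierStokesRegularity.NavierStokesRegularity.Theorems.FilamentSkeletonRssSkeletonJ1RLiaSelfWindow

/-!
# Crux `SkeletonJ1R` (stmt-NavierStokesRegularity-23610) · line `streamline_kantorovich_R` · toward stub F2-d (`LiaDefectDerivBL`, v7), brick S2′ (inner) for B1′:
# THE LOGARITHMIC-WINDOW POINTWISE MAJORANT FOR THE SYMMETRIZED SELF-STRAND DERIVATIVE INTEGRAND against the model `K_e(s)(s²/2)•X′τ × X‴τ`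

Hand `leafhand-ns-filamentskeletonrs-1` (gen 0), `--supports stmt-NavierStokesRegularity-23610 --as helper`.  MODEL rung, NEGATIVE side of the ladder:
kernel calculus for a HYPOTHETICAL filament-type blow-up skeleton; nothing here is a claim about Navier–Stokes regularity; the stub and the crux stay OPEN.

Derivative analogue of `…LiaSelfWindow.norm_selfIntegrand_sub_windowModel_le` (S2 INNER).  Unit-speed `C²` curve which is `C³` ON THE SEGMENT `[[σ, τ]]`:
`X″` has derivative `Z` there with `‖Z‖ ≤ H` and `‖Z p − Z τ‖ ≤ H′|p − τ|`; curvature `≤ κ` on the segment; local chord `(1−η)|σ−τ| ≤ ‖Xσ − Xτ‖`, `η ≤ 1/2`.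
Then the symmetrized derivative integrand `D(σ) = (−3⟪w, Δ⟫K₅(w))•X′σ×w + K₃(w)•(X′σ×Δ + X″σ×w)` (`w = Xτ − Xσ`, `Δ = X′τ − X′σ`, kernels
`K₃ = ((‖w‖²+e²)^{3/2})⁻¹`, `K₅ = ((‖w‖²+e²)^{5/2})⁻¹`) satisfies
  `‖D(σ) − K_e(σ−τ)((σ−τ)²/2) • X′τ × Zτ‖ ≤ 8H′ + 84κH + 16ηH·(K_e(σ−τ)(σ−τ)²/2)`     (`norm_symmDerivIntegrand_sub_windowModel_le`).
Ingredients: the second-order split `X′σ×Δ + X″σ×w = X′σ×A₁ + X″σ×A₀` (`…LiaSelfDerivSplit.cross_symm_split`), the fourth-order radial factor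
`|⟪w, Δ⟫| ≤ (3/2)κH s⁴` (`…LiaSelfDerivRadial`), the new third-order bound `‖A₁ − (s²/2)•Zτ‖ ≤ H′|s|³` (`norm_derivIncrement_sub_halfSq_smul_le`, mean value
twice), and the kernel toolkit of S2 (`kernel_chord_sub_le`, `cube_mul_kernel_le_one`).  With `H′ ≍ H/ℓ` (the reference's `x‴` varies on the collar scale) every
term is within the RATE-B budget of B1′ after `× ℓ·Γγ_j/4π` and integration over `|s| ≤ R ≍ √Γ` (plan: crux evidence #53).
-/

set_option linter.dupNamespace false -- `NavierStokesRegularity.NavierStokesRegularity` path/namespace repetition is the tree convention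

noncomputable section

namespace Summit.NavierStokesRegularity.NavierStokesRegularity.Theorems.SkeletonJ1RLiaSelf

open Set Function Filter Real Topology MeasureTheory intervalIntegral
open Literature.Analysis.FluidPDE
open scoped InnerProductSpace BigOperators Interval

variable {X : ℝ → EuclideanSpace ℝ (Fin 3)}

/-! ## §1 The tangent increment against `(s²/2)•X‴τ` -/

/-- **`‖X′τ − X′σ − (τ−σ)•X″σ − ((τ−σ)²/2)•Zτ‖ ≤ H′|τ−σ|³`** when `X″` has derivative `Z` on `[[σ, τ]]` with `‖Z p − Z τ‖ ≤ H′|p − τ|` there. [folklore] -/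
theorem norm_derivIncrement_sub_halfSq_smul_le (hX : ContDiff ℝ 2 X) {τ σ H' : ℝ} {Z : ℝ → EuclideanSpace ℝ (Fin 3)} (hH'0 : 0 ≤ H')
    (hZ : ∀ p ∈ uIcc σ τ, HasDerivAt (deriv (deriv X)) (Z p) p) (hZlip : ∀ p ∈ uIcc σ τ, ‖Z p - Z τ‖ ≤ H' * |p - τ|) :
    ‖deriv X τ - deriv X σ - (τ - σ) • deriv (deriv X) σ - ((τ - σ) ^ 2 / 2) • Z τ‖ ≤ H' * |τ - σ| ^ 3 := by
  have hd : Differentiable ℝ (deriv X) := hX.differentiable_deriv_two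
  have hc : Continuous (deriv (deriv X)) := continuous_deriv_two hX
  -- g(p) = X″p − X″σ − (p−σ)•Zτ, ‖g p‖ ≤ H′|τ−σ|·|p−σ| on the segment
  set g : ℝ → EuclideanSpace ℝ (Fin 3) := fun p => deriv (deriv X) p - deriv (deriv X) σ - (p - σ) • Z τ with hg
  have hgd : ∀ p ∈ uIcc σ τ, HasDerivWithinAt g (Z p - Z τ) (uIcc σ τ) p := by
    intro p hp
    have h1 : HasDerivAt (fun p => deriv (deriv X) p - deriv (deriv X) σ) (Z p) p := (hZ p hp).sub_const _
    have h2 : HasDerivAt (fun p : ℝ => (p - σ) • Z τ) ((1:ℝ) • Z τ) p := ((hasDerivAt_id p).sub_const σ).smul_const (Z τ)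
    rw [one_smul] at h2
    exact (h1.sub h2).hasDerivWithinAt
  have hgb : ∀ p ∈ uIcc σ τ, ‖Z p - Z τ‖ ≤ H' * |τ - σ| := fun p hp => by
    refine (hZlip p hp).trans (mul_le_mul_of_nonneg_left ?_ hH'0)
    have h := abs_sub_left_le_of_mem_uIcc (uIcc_comm σ τ ▸ hp : p ∈ uIcc τ σ)
    rwa [abs_sub_comm σ τ] at h
  have hgn : ∀ p ∈ uIcc σ τ, ‖g p‖ ≤ H' * |τ - σ| * |p - σ| := by
    intro p hp
    have h := Convex.norm_image_sub_le_of_norm_hasDerivWithin_le hgd hgb (convex_uIcc σ τ) left_mem_uIcc hp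
    have hg0 : g σ = 0 := by simp [hg]
    rw [hg0, sub_zero] at h
    simpa [Real.norm_eq_abs] using h
  -- the increment as an integral of g
  have I1 : IntervalIntegrable (fun p => deriv (deriv X) p - deriv (deriv X) σ) volume σ τ := (hc.sub continuous_const).intervalIntegrable _ _
  have I2 : IntervalIntegrable (fun p : ℝ => (p - σ) • Z τ) volume σ τ := ((continuous_id.sub continuous_const).smul continuous_const).intervalIntegrable _ _
  have heq : deriv X τ - deriv X σ - (τ - σ) • deriv (deriv X) σ - ((τ - σ) ^ 2 / 2) • Z τ = ∫ p in σ..τ, g p := by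
    rw [hg, intervalIntegral.integral_sub I1 I2, intervalIntegral.integral_smul_const, integral_sub_left,
      intervalIntegral.integral_sub (hc.intervalIntegrable _ _) (continuous_const.intervalIntegrable _ _), intervalIntegral.integral_const,
      integral_deriv_eq_sub (fun x _ => hd x) (hc.intervalIntegrable _ _)]
  rw [heq]
  have hb : ∀ p ∈ Ι σ τ, ‖g p‖ ≤ H' * |τ - σ| * |τ - σ| := fun p hp => by
    have hp' : p ∈ uIcc σ τ := uIoc_subset_uIcc hp
    exact (hgn p hp').trans (mul_le_mul_of_nonneg_left (abs_sub_left_le_of_mem_uIcc hp') (by positivity))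
  calc ‖∫ p in σ..τ, g p‖ ≤ H' * |τ - σ| * |τ - σ| * |τ - σ| := intervalIntegral.norm_integral_le_of_norm_le_const hb
    _ = H' * |τ - σ| ^ 3 := by ring

/-! ## §2 The inner pointwise majorant -/

set_option maxHeartbeats 800000 in
/-- **INNER (log-window) pointwise majorant for the symmetrized derivative integrand** (see the module docstring). [folklore] -/
theorem norm_symmDerivIntegrand_sub_windowModel_le (hX : ContDiff ℝ 2 X) (hunit : ∀ s, ‖deriv X s‖ = 1) {e : ℝ} (he : 0 < e)
    {τ σ κ H H' η : ℝ} {Z : ℝ → EuclideanSpace ℝ (Fin 3)} (hκ : ∀ p ∈ uIcc σ τ, ‖deriv (deriv X) p‖ ≤ κ) (hH0 : 0 ≤ H)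
    (hH : ∀ q ∈ uIcc σ τ, ‖deriv (deriv X) q - deriv (deriv X) σ‖ ≤ H * |q - σ|)
    (hZ : ∀ p ∈ uIcc σ τ, HasDerivAt (deriv (deriv X)) (Z p) p) (hZτ : ‖Z τ‖ ≤ H) (hH'0 : 0 ≤ H')
    (hZlip : ∀ p ∈ uIcc σ τ, ‖Z p - Z τ‖ ≤ H' * |p - τ|)
    (hη0 : 0 ≤ η) (hη1 : η ≤ 1 / 2) (hchord : (1 - η) * |σ - τ| ≤ ‖X σ - X τ‖) :
    ‖((-3 * ⟪X τ - X σ, deriv X τ - deriv X σ⟫_ℝ * ((‖X τ - X σ‖ ^ 2 + e ^ 2) ^ (5 / 2 : ℝ))⁻¹) • cross (deriv X σ) (X τ - X σ) +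
        ((‖X τ - X σ‖ ^ 2 + e ^ 2) ^ (3 / 2 : ℝ))⁻¹ • (cross (deriv X σ) (deriv X τ - deriv X σ) + cross (deriv (deriv X) σ) (X τ - X σ))) -
        (((((σ - τ) ^ 2 + e ^ 2) ^ (3 / 2 : ℝ))⁻¹ * ((σ - τ) ^ 2 / 2)) • cross (deriv X τ) (Z τ))‖ ≤
      8 * H' + 84 * (κ * H) + 16 * η * H * ((((σ - τ) ^ 2 + e ^ 2) ^ (3 / 2 : ℝ))⁻¹ * ((σ - τ) ^ 2 / 2)) := by
  have hκ0 : 0 ≤ κ := (norm_nonneg _).trans (hκ σ left_mem_uIcc)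
  set s := τ - σ with hs
  have hsστ : (σ - τ) ^ 2 = s ^ 2 := by rw [hs]; ring
  have hsabs : |σ - τ| = |s| := by rw [hs, abs_sub_comm]
  set w := X τ - X σ with hw
  set Δ := deriv X τ - deriv X σ with hΔ
  set Kc : ℝ := ((‖w‖ ^ 2 + e ^ 2) ^ (3 / 2 : ℝ))⁻¹ with hKc
  set K5 : ℝ := ((‖w‖ ^ 2 + e ^ 2) ^ (5 / 2 : ℝ))⁻¹ with hK5
  set Ks : ℝ := ((s ^ 2 + e ^ 2) ^ (3 / 2 : ℝ))⁻¹ with hKs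
  rw [hsστ]
  have hKc0 : 0 ≤ Kc := (kernel_pos e _ he).le
  have hKs0 : 0 ≤ Ks := (kernel_pos e _ he).le
  have hK50 : 0 ≤ K5 := inv_nonneg.2 (Real.rpow_nonneg (by positivity) _)
  have hpos : 0 < ‖w‖ ^ 2 + e ^ 2 := by positivity
  -- Taylor data
  set A₁ := deriv X τ - deriv X σ - (τ - σ) • deriv (deriv X) σ with hA₁
  set A₀ := X τ - X σ - (τ - σ) • deriv X σ - ((τ - σ) ^ 2 / 2) • deriv (deriv X) σ with hA₀
  have hA₁Z : ‖A₁ - (s ^ 2 / 2) • Z τ‖ ≤ H' * |s| ^ 3 := norm_derivIncrement_sub_halfSq_smul_le hX hH'0 hZ hZlip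
  have hA₀n : ‖A₀‖ ≤ H * |s| ^ 3 := norm_taylorThree_le hX hH0 hH
  have hΔn : ‖Δ‖ ≤ κ * |s| := norm_deriv_sub_deriv_le_on hX (τ := σ) (σ := τ) hκ
  have hrad : |⟪w, Δ⟫_ℝ| ≤ 3 / 2 * κ * H * s ^ 4 := abs_inner_chord_tangentIncrement_le_fourth hX hunit hκ hH0 hH
  -- chord facts
  have hchord' : (1 - η) * |s| ≤ ‖w‖ := by rw [hw, norm_sub_rev, ← hsabs]; exact hchord
  have hwle : ‖w‖ ≤ |s| := by
    have hd : Differentiable ℝ X := hX.differentiable (by norm_num)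
    have h := Convex.norm_image_sub_le_of_norm_deriv_le (f := X) (C := 1) (s := Set.univ) (fun x _ => hd x)
      (fun x _ => (hunit x).le) convex_univ (Set.mem_univ σ) (Set.mem_univ τ)
    rwa [one_mul, Real.norm_eq_abs] at h
  have hKcKs : Kc - Ks ≤ 16 * η * Ks := by rw [hKc, hKs]; exact kernel_chord_sub_le he hη0 hη1 hchord'
  have hKcKs0 : 0 ≤ Kc - Ks := by
    rw [hKc, hKs, sub_nonneg]
    refine inv_anti₀ (Real.rpow_pos_of_pos (by positivity) _) (Real.rpow_le_rpow (by positivity) ?_ (by norm_num))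
    nlinarith [sq_abs s, pow_le_pow_left₀ (norm_nonneg _) hwle 2]
  have hKcs3 : Kc * |s| ^ 3 ≤ 8 := by
    have h1 : ‖w‖ ^ 3 * Kc ≤ 1 := by rw [hKc]; exact cube_mul_kernel_le_one (norm_nonneg _) he
    have h2 : |s| / 2 ≤ ‖w‖ := by
      have : (1:ℝ) / 2 * |s| ≤ (1 - η) * |s| := mul_le_mul_of_nonneg_right (by linarith) (abs_nonneg _)
      linarith
    have h3 : (|s| / 2) ^ 3 ≤ ‖w‖ ^ 3 := pow_le_pow_left₀ (by positivity) h2 3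
    nlinarith [mul_le_mul_of_nonneg_right h3 hKc0]
  -- the algebraic rearrangement
  have hsplit : cross (deriv X σ) Δ + cross (deriv (deriv X) σ) w = cross (deriv X σ) A₁ + cross (deriv (deriv X) σ) A₀ := by
    rw [hΔ, hw, hA₁, hA₀]; exact cross_symm_split _ _ _ _ (τ - σ)
  have hdiff : ((-3 * ⟪w, Δ⟫_ℝ * K5) • cross (deriv X σ) w + Kc • (cross (deriv X σ) Δ + cross (deriv (deriv X) σ) w)) -
        (Ks * (s ^ 2 / 2)) • cross (deriv X τ) (Z τ) =
      (-3 * ⟪w, Δ⟫_ℝ * K5) • cross (deriv X σ) w +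
        (Kc • (cross (deriv X σ) (A₁ - (s ^ 2 / 2) • Z τ) + (s ^ 2 / 2) • cross (deriv X σ - deriv X τ) (Z τ) +
            cross (deriv (deriv X) σ) A₀) +
          ((Kc - Ks) * (s ^ 2 / 2)) • cross (deriv X τ) (Z τ)) := by
    rw [hsplit]
    have e1 : cross (deriv X σ) (A₁ - (s ^ 2 / 2) • Z τ) = cross (deriv X σ) A₁ - (s ^ 2 / 2) • cross (deriv X σ) (Z τ) := by
      rw [← crossCLM_apply, map_sub, map_smul]; rfl
    have e2 : cross (deriv X σ - deriv X τ) (Z τ) = cross (deriv X σ) (Z τ) - cross (deriv X τ) (Z τ) := by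
      rw [← crossCLM_apply, map_sub]; rfl
    rw [e1, e2]
    simp only [smul_sub, smul_add, sub_smul, mul_smul]
    abel
  rw [hdiff]
  -- piece 1: the radial term
  have p1 : ‖(-3 * ⟪w, Δ⟫_ℝ * K5) • cross (deriv X σ) w‖ ≤ 72 * (κ * H) := by
    rcases eq_or_ne s 0 with hs0 | hs0
    · have hw0 : w = 0 := by
        have : ‖w‖ ≤ 0 := by rw [hs0, abs_zero] at hwle; exact hwle
        exact norm_le_zero_iff.1 this
      rw [hw0, ← crossCLM_apply, map_zero, smul_zero, norm_zero]; positivity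
    have hsa : 0 < |s| := abs_pos.2 hs0
    have hwpos : 0 < ‖w‖ := lt_of_lt_of_le (by nlinarith : 0 < (1 - η) * |s|) hchord'
    -- K5 ‖w‖ ≤ Kc / ‖w‖
    have hK5w : K5 * ‖w‖ ≤ Kc * ‖w‖⁻¹ := by
      have h52 : (‖w‖ ^ 2 + e ^ 2) ^ (5 / 2 : ℝ) = (‖w‖ ^ 2 + e ^ 2) ^ (3 / 2 : ℝ) * (‖w‖ ^ 2 + e ^ 2) := by
        rw [show (5 / 2 : ℝ) = 3 / 2 + 1 by norm_num, Real.rpow_add hpos, Real.rpow_one]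
      rw [hK5, h52, mul_inv, hKc, mul_assoc]
      refine mul_le_mul_of_nonneg_left ?_ hKc0
      rw [← div_eq_inv_mul, div_le_iff₀ hpos, inv_mul_eq_div, le_div_iff₀ hwpos]
      nlinarith [sq_nonneg e]
    have hwinv : ‖w‖⁻¹ ≤ 2 * |s|⁻¹ := by
      have h2 : |s| / 2 ≤ ‖w‖ := by
        have : (1:ℝ) / 2 * |s| ≤ (1 - η) * |s| := mul_le_mul_of_nonneg_right (by linarith) (abs_nonneg _)
        linarith
      calc ‖w‖⁻¹ ≤ (|s| / 2)⁻¹ := inv_anti₀ (by positivity) h2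
        _ = 2 * |s|⁻¹ := by rw [inv_div]; ring
    rw [norm_smul, Real.norm_eq_abs, abs_mul, abs_mul, abs_neg, abs_of_pos (by norm_num : (0:ℝ) < 3), abs_of_nonneg hK50]
    have hcw : ‖cross (deriv X σ) w‖ ≤ ‖w‖ := norm_cross_unit_le (hunit σ) w
    have hs4 : s ^ 4 = |s| ^ 3 * |s| := by
      have h4 : |s| ^ 4 = s ^ 4 := by
        have hsq := sq_abs s
        calc |s| ^ 4 = (|s| ^ 2) ^ 2 := by ring
          _ = (s ^ 2) ^ 2 := by rw [hsq]
          _ = s ^ 4 := by ring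
      rw [← h4]; ring
    calc 3 * |⟪w, Δ⟫_ℝ| * K5 * ‖cross (deriv X σ) w‖ ≤ 3 * (3 / 2 * κ * H * s ^ 4) * K5 * ‖w‖ := by gcongr
      _ = 3 * (3 / 2 * κ * H * s ^ 4) * (K5 * ‖w‖) := by ring
      _ ≤ 3 * (3 / 2 * κ * H * s ^ 4) * (Kc * ‖w‖⁻¹) := mul_le_mul_of_nonneg_left hK5w (by positivity)
      _ ≤ 3 * (3 / 2 * κ * H * s ^ 4) * (Kc * (2 * |s|⁻¹)) := by gcongr
      _ = 9 * (κ * H) * (Kc * |s| ^ 3) * (|s| * |s|⁻¹) := by rw [hs4]; ring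
      _ = 9 * (κ * H) * (Kc * |s| ^ 3) := by rw [mul_inv_cancel₀ hsa.ne', mul_one]
      _ ≤ 9 * (κ * H) * 8 := mul_le_mul_of_nonneg_left hKcs3 (by positivity)
      _ = 72 * (κ * H) := by ring
  -- piece 2: Kc • (second-order numerator against the model)
  have p2 : ‖Kc • (cross (deriv X σ) (A₁ - (s ^ 2 / 2) • Z τ) + (s ^ 2 / 2) • cross (deriv X σ - deriv X τ) (Z τ) +
      cross (deriv (deriv X) σ) A₀)‖ ≤ 8 * H' + 12 * (κ * H) := by
    rw [norm_smul, Real.norm_eq_abs, abs_of_nonneg hKc0]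
    have q1 : ‖cross (deriv X σ) (A₁ - (s ^ 2 / 2) • Z τ)‖ ≤ H' * |s| ^ 3 := (norm_cross_unit_le (hunit σ) _).trans hA₁Z
    have q2 : ‖(s ^ 2 / 2) • cross (deriv X σ - deriv X τ) (Z τ)‖ ≤ s ^ 2 / 2 * (κ * |s| * H) := by
      rw [norm_smul, Real.norm_of_nonneg (by positivity)]
      refine mul_le_mul_of_nonneg_left ((norm_cross_le_norm_mul_norm _ _).trans ?_) (by positivity)
      have : ‖deriv X σ - deriv X τ‖ ≤ κ * |s| := by rw [norm_sub_rev]; exact hΔn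
      exact mul_le_mul this hZτ (norm_nonneg _) (by positivity)
    have q3 : ‖cross (deriv (deriv X) σ) A₀‖ ≤ κ * (H * |s| ^ 3) :=
      (norm_cross_le_norm_mul_norm _ _).trans (mul_le_mul (hκ σ left_mem_uIcc) hA₀n (norm_nonneg _) hκ0)
    have hsum : ‖cross (deriv X σ) (A₁ - (s ^ 2 / 2) • Z τ) + (s ^ 2 / 2) • cross (deriv X σ - deriv X τ) (Z τ) +
        cross (deriv (deriv X) σ) A₀‖ ≤ (H' + 3 / 2 * (κ * H)) * |s| ^ 3 := by
      have h := norm_add₃_le (a := cross (deriv X σ) (A₁ - (s ^ 2 / 2) • Z τ)) (b := (s ^ 2 / 2) • cross (deriv X σ - deriv X τ) (Z τ))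
        (c := cross (deriv (deriv X) σ) A₀)
      have hs2 : s ^ 2 = |s| ^ 2 := (sq_abs s).symm
      calc _ ≤ H' * |s| ^ 3 + s ^ 2 / 2 * (κ * |s| * H) + κ * (H * |s| ^ 3) := h.trans (add_le_add (add_le_add q1 q2) q3)
        _ = (H' + 3 / 2 * (κ * H)) * |s| ^ 3 := by rw [hs2]; ring
    calc Kc * ‖_‖ ≤ Kc * ((H' + 3 / 2 * (κ * H)) * |s| ^ 3) := mul_le_mul_of_nonneg_left hsum hKc0
      _ = (H' + 3 / 2 * (κ * H)) * (Kc * |s| ^ 3) := by ring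
      _ ≤ (H' + 3 / 2 * (κ * H)) * 8 := mul_le_mul_of_nonneg_left hKcs3 (by positivity)
      _ = 8 * H' + 12 * (κ * H) := by ring
  -- piece 3: kernel comparison
  have p3 : ‖((Kc - Ks) * (s ^ 2 / 2)) • cross (deriv X τ) (Z τ)‖ ≤ 16 * η * H * (Ks * (s ^ 2 / 2)) := by
    rw [norm_smul, Real.norm_eq_abs, abs_of_nonneg (mul_nonneg hKcKs0 (by positivity))]
    have hCE : ‖cross (deriv X τ) (Z τ)‖ ≤ H := (norm_cross_unit_le (hunit τ) _).trans hZτ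
    have h16 : 0 ≤ 16 * η * Ks * (s ^ 2 / 2) := mul_nonneg (mul_nonneg (by positivity) hKs0) (by positivity)
    calc (Kc - Ks) * (s ^ 2 / 2) * ‖cross (deriv X τ) (Z τ)‖ ≤ (16 * η * Ks) * (s ^ 2 / 2) * H :=
          mul_le_mul (mul_le_mul_of_nonneg_right hKcKs (by positivity)) hCE (norm_nonneg _) h16
      _ = 16 * η * H * (Ks * (s ^ 2 / 2)) := by ring
  calc _ ≤ ‖(-3 * ⟪w, Δ⟫_ℝ * K5) • cross (deriv X σ) w‖ +
        ‖Kc • (cross (deriv X σ) (A₁ - (s ^ 2 / 2) • Z τ) + (s ^ 2 / 2) • cross (deriv X σ - deriv X τ) (Z τ) +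
            cross (deriv (deriv X) σ) A₀) +
          ((Kc - Ks) * (s ^ 2 / 2)) • cross (deriv X τ) (Z τ)‖ := norm_add_le _ _
    _ ≤ ‖(-3 * ⟪w, Δ⟫_ℝ * K5) • cross (deriv X σ) w‖ +
        (‖Kc • (cross (deriv X σ) (A₁ - (s ^ 2 / 2) • Z τ) + (s ^ 2 / 2) • cross (deriv X σ - deriv X τ) (Z τ) +
            cross (deriv (deriv X) σ) A₀)‖ +
          ‖((Kc - Ks) * (s ^ 2 / 2)) • cross (deriv X τ) (Z τ)‖) := by gcongr; exact norm_add_le _ _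
    _ ≤ 72 * (κ * H) + ((8 * H' + 12 * (κ * H)) + 16 * η * H * (Ks * (s ^ 2 / 2))) := add_le_add p1 (add_le_add p2 p3)
    _ = 8 * H' + 84 * (κ * H) + 16 * η * H * (Ks * (s ^ 2 / 2)) := by ring

end Summit.NavierStokesRegularity.NavierStokesRegularity.Theorems.SkeletonJ1RLiaSelf

end
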